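import Summits.BirchSwinnertonDyer.BirchSwinnertonDyer.Theorems.ClassRecordThreeShimuraKolyvaginOrderBoundAtThreeRungSEmptyOfInputs
import HarnessLib

/-!
# Crux `ShimuraKolyvaginOrderBoundAtThree` (item 19616) REDUCES to its `S ≠ ∅` slice under each route's
# own published-inputs binder — the `S = ∅` slice (the BC5 rung) is discharged, kernel-free

Cell `bsd-stepL` (run/shared/lean/pub/bsd-stepL/), seat `bsd-stepL-shim-p2` (gen 2). Routes
`route-BirchSwinnertonDyer-ClassRecordThree` (K2@3) and `route-BirchSwinnertonDyer-KolyvaginRoadThree`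
(KOLY) share the crux item stmt-BirchSwinnertonDyer-19616: Kolyvagin's ORDER bound
`#Ш(E/K)[3^∞] ≤ 3^{2·ord_3[E(K):ℤP]}` for displayed points on the Shimura curves `X_{N⁺,N⁻}`,
`N⁻ = ∏ S` (`S` an even set of primes inert in `K`), at `p = 3 ∣ N⁺`. Both `closes` theorems take the
crux as the hypothesis `hKO` next to the published-inputs binder (`h₆ : PublishedInputsThree`, resp.
`h₇ : PublishedInputsKolyThree`) and rebuild the Literature fact
`shimuraCurve_heegnerPoint_grossZagier_kolyvagin` from `hSGZ`, `hKO`, `hOff`.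

By `stub_rung_orderBound_SEmptyAtThree_of_publishedInputsThree` /
`…_of_publishedInputsKolyThree` (file `…RungSEmptyOfInputs`), the `S = ∅` slice of `hKO` (the
modular curve `X₀(N)`: Cha 2005 Thm. 21 / Matar–Nekovář 2019 Thm. 0.3, with the index transfer
`y_K ↦ P` of `…RungSEmpty`) already follows from the published-inputs binder. HENCE, kernel-free:

* `shimuraKolyvaginOrderBoundAtThree_of_publishedInputsThree_of_nonempty` —
  `PublishedInputsThree → (crux restricted to S.Nonempty) → ShimuraKolyvaginOrderBoundAtThree` (K2@3 decl);
* `koly_shimuraKolyvaginOrderBoundAtThree_of_publishedInputsKolyThree_of_nonempty` — the same for the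
  KOLY copy of the decl (`Theses.KolyvaginRoadThree.ShimuraKolyvaginOrderBoundAtThree`, identical text);
* the trivial converses `…_nonempty_of` (the full crux implies its `S.Nonempty` slice), so that under the
  binder the crux and its `S ≠ ∅` slice are EQUIVALENT.

USE (planner's call, not done here): the crux item may be re-declared as its `S.Nonempty` slice (one
extra binder `S.Nonempty →` after `W.conductorNorm ℤ = N →`), `closes` re-glued through the first /
second theorem with the binder it already holds — the genuinely OPEN content of 19616 is exactly the
Shimura-curve case `N⁻ > 1` (stubs `stub_orderBound_surjAtThree` / `stub_orderBound_irredNonSurjAtThree`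
of the registered skeleton restricted to `S ≠ ∅`). Where the kernel consumer
`missingUpperBoundAt_of_ram_of_not_alpha_of_shape_pub_odd` builds its set `S` (the split multiplicative
`ℓ ≠ p` with `p ∣ v_ℓ(Δ)`, padded to even size by the (ram) witness), `S = ∅` does occur (no such `ℓ`),
so the `S = ∅` slice IS consumed — and is now supplied by print.

HONEST FRAMING: theorems only, CONDITIONAL on the displayed published inputs and on the `S ≠ ∅` slice
(statement-shaped hypothesis `hKO'`, the would-be restated crux); nothing booked; no route file, crux
text or skeleton touched. References: [Cha2005] Thm. 21; [MatarNekovar2019] Thm. 0.3, §0.11;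
[JetchevSkinnerWan2017] Thm. 4.4.1, §7.4.1; [CaiShuTian2014] Thm. 1.1.
-/

noncomputable section

open scoped Classical

set_option linter.dupNamespace false

open WeierstrassCurve NumberField Literature.NumberTheory.EllipticCurves
  Literature.NumberTheory.EllipticCurves.ModularForms
  Literature.NumberTheory.EllipticCurves.Rank1Residual
  Literature.NumberTheory.Automorphic CongruenceSubgroup

namespace Summit.BirchSwinnertonDyer.BirchSwinnertonDyer.Theorems.ShimuraKolyvaginRungSEmpty

/-- **Crux 19616 from its `S ≠ ∅` slice, under `PublishedInputsThree` (K2@3).** If the class record's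
published inputs hold (`h₆`, the binder `closes` already carries) and Kolyvagin's order bound holds for
displayed points on every GENUINE Shimura curve `X_{N⁺,N⁻}` of the crux (`S` non-empty: `N⁻ > 1`), then
the crux `ShimuraKolyvaginOrderBoundAtThree` holds as declared (all even `S`): the case `S = ∅` is
`stub_rung_orderBound_SEmptyAtThree_of_publishedInputsThree` (the modular curve, in print: Cha 2005
Thm. 21 / Matar–Nekovář 2019 Thm. 0.3 via the index transfer), the case `S ≠ ∅` is the hypothesis.
CONDITIONAL (published inputs + the `S ≠ ∅` slice); nothing booked.
[cite: MatarNekovar2019, Thm. 0.3 (p. 456), §0.11 (p. 457)] [cite: Cha2005, Thm. 21 (p. 173)]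
[cite: JetchevSkinnerWan2017, Thm. 4.4.1] -/
theorem shimuraKolyvaginOrderBoundAtThree_of_publishedInputsThree_of_nonempty
    (h₆ : Summit.BirchSwinnertonDyer.BirchSwinnertonDyer.Theses.ClassRecordThree.PublishedInputsThree)
    (hKO' : ∀ (W : WeierstrassCurve ℚ) [W.IsElliptic] [W.IsGloballyMinimal] (p : ℕ) [Fact p.Prime]
      (N : ℕ) [NeZero N] (K : Type) [Field K] [NumberField K] (S : Finset ℕ)
      (Dt : ModularParametrizationData W N)
      (X : ShimuraCurveData (∏ q ∈ S, q) (N / ∏ q ∈ S, q))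
      (W' : WeierstrassCurve ℚ) [W'.IsElliptic] (P₀ : ShimuraParametrizationData X W'),
      W.conductorNorm ℤ = N → S.Nonempty → p ≠ 2 → W.HasIrreducibleModPGaloisRep p →
      IsImaginaryQuadratic K → Even S.card →
      (∀ ℓ ∈ S, ℓ.Prime ∧ ℓ ∣ N ∧ ¬ ℓ ^ 2 ∣ N ∧
        ((Ideal.span {(ℓ : ℤ)}).primesOver (𝓞 K)).ncard = 1 ∧ ¬ (ℓ : ℤ) ∣ NumberField.discr K) →
      (∀ ℓ : ℕ, ℓ.Prime → ℓ ∣ N → ℓ ∉ S → ((Ideal.span {(ℓ : ℤ)}).primesOver (𝓞 K)).ncard = 2) →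
      ((Ideal.span {(p : ℤ)}).primesOver (𝓞 K)).ncard = 2 →
      P₀.IsMinimalFor W →
      p ∣ N → p = 3 →
      ∀ (P : (W.baseChange K).toAffine.Point) (degS : ℕ), 0 < degS →
        padicValNat p degS = padicValNat p P₀.deg →
        LDerivEK W K =
          8 * (Real.pi : ℂ) ^ 2 * peterssonProduct (Gamma0 N) 2 Dt.f Dt.f /
              ((((Units.torsionOrder K : ℝ) / 2) ^ 2 * √|(NumberField.discr K : ℝ)| : ℝ) : ℂ) *
            ((P.canonicalHeight : ℂ) / (degS : ℂ)) →
        ¬ IsOfFinAddOrder P →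
          Nat.card (AddCommGroup.primaryComponent (W.baseChange K).sha p) ≤
            p ^ (2 * padicValNat p (AddSubgroup.zmultiples P).index)) :
    Summit.BirchSwinnertonDyer.BirchSwinnertonDyer.Theses.ClassRecordThree.ShimuraKolyvaginOrderBoundAtThree := by
  intro W _ _ p _ N _ K _ _ S Dt X W' _ P₀ hN hp2 hirr hK hev hin hsp hps hmin hpN hp3 P degS h0 hv hL hnt
  rcases S.eq_empty_or_nonempty with hS | hS
  · exact stub_rung_orderBound_SEmptyAtThree_of_publishedInputsThree h₆ W p N K S Dt X W' P₀ hN hS hp2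
      hirr hK hev hin hsp hps hmin hpN hp3 P degS h0 hv hL hnt
  · exact hKO' W p N K S Dt X W' P₀ hN hS hp2 hirr hK hev hin hsp hps hmin hpN hp3 P degS h0 hv hL hnt

/-- **The converse (trivial): the crux implies its `S ≠ ∅` slice** (K2@3 decl) — so that, under
`PublishedInputsThree`, crux 19616 and its `S ≠ ∅` slice are equivalent. [folklore] -/
theorem shimuraKolyvaginOrderBoundAtThree_nonempty_of
    (hKO : Summit.BirchSwinnertonDyer.BirchSwinnertonDyer.Theses.ClassRecordThree.ShimuraKolyvaginOrderBoundAtThree) :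
    ∀ (W : WeierstrassCurve ℚ) [W.IsElliptic] [W.IsGloballyMinimal] (p : ℕ) [Fact p.Prime]
      (N : ℕ) [NeZero N] (K : Type) [Field K] [NumberField K] (S : Finset ℕ)
      (Dt : ModularParametrizationData W N)
      (X : ShimuraCurveData (∏ q ∈ S, q) (N / ∏ q ∈ S, q))
      (W' : WeierstrassCurve ℚ) [W'.IsElliptic] (P₀ : ShimuraParametrizationData X W'),
      W.conductorNorm ℤ = N → S.Nonempty → p ≠ 2 → W.HasIrreducibleModPGaloisRep p →
      IsImaginaryQuadratic K → Even S.card →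
      (∀ ℓ ∈ S, ℓ.Prime ∧ ℓ ∣ N ∧ ¬ ℓ ^ 2 ∣ N ∧
        ((Ideal.span {(ℓ : ℤ)}).primesOver (𝓞 K)).ncard = 1 ∧ ¬ (ℓ : ℤ) ∣ NumberField.discr K) →
      (∀ ℓ : ℕ, ℓ.Prime → ℓ ∣ N → ℓ ∉ S → ((Ideal.span {(ℓ : ℤ)}).primesOver (𝓞 K)).ncard = 2) →
      ((Ideal.span {(p : ℤ)}).primesOver (𝓞 K)).ncard = 2 →
      P₀.IsMinimalFor W →
      p ∣ N → p = 3 →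
      ∀ (P : (W.baseChange K).toAffine.Point) (degS : ℕ), 0 < degS →
        padicValNat p degS = padicValNat p P₀.deg →
        LDerivEK W K =
          8 * (Real.pi : ℂ) ^ 2 * peterssonProduct (Gamma0 N) 2 Dt.f Dt.f /
              ((((Units.torsionOrder K : ℝ) / 2) ^ 2 * √|(NumberField.discr K : ℝ)| : ℝ) : ℂ) *
            ((P.canonicalHeight : ℂ) / (degS : ℂ)) →
        ¬ IsOfFinAddOrder P →
          Nat.card (AddCommGroup.primaryComponent (W.baseChange K).sha p) ≤
            p ^ (2 * padicValNat p (AddSubgroup.zmultiples P).index) :=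
  fun W _ _ p _ N _ K _ _ S Dt X W' _ P₀ hN _ ↦ hKO W p N K S Dt X W' P₀ hN

/-- **Crux 19616 from its `S ≠ ∅` slice, under `PublishedInputsKolyThree` (KOLY).** The KOLY route's
copy of the crux decl (`Theses.KolyvaginRoadThree.ShimuraKolyvaginOrderBoundAtThree`, identical text)
follows from the route's published-inputs binder `h₇` and the `S ≠ ∅` slice: `S = ∅` by
`stub_rung_orderBound_SEmptyAtThree_of_publishedInputsKolyThree`, `S ≠ ∅` by hypothesis.
CONDITIONAL (published inputs + the `S ≠ ∅` slice); nothing booked.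
[cite: MatarNekovar2019, Thm. 0.3 (p. 456), §0.11 (p. 457)] [cite: Cha2005, Thm. 21 (p. 173)]
[cite: JetchevSkinnerWan2017, Thm. 4.4.1] -/
theorem koly_shimuraKolyvaginOrderBoundAtThree_of_publishedInputsKolyThree_of_nonempty
    (h₇ : Summit.BirchSwinnertonDyer.BirchSwinnertonDyer.Theses.KolyvaginRoadThree.PublishedInputsKolyThree)
    (hKO' : ∀ (W : WeierstrassCurve ℚ) [W.IsElliptic] [W.IsGloballyMinimal] (p : ℕ) [Fact p.Prime]
      (N : ℕ) [NeZero N] (K : Type) [Field K] [NumberField K] (S : Finset ℕ)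
      (Dt : ModularParametrizationData W N)
      (X : ShimuraCurveData (∏ q ∈ S, q) (N / ∏ q ∈ S, q))
      (W' : WeierstrassCurve ℚ) [W'.IsElliptic] (P₀ : ShimuraParametrizationData X W'),
      W.conductorNorm ℤ = N → S.Nonempty → p ≠ 2 → W.HasIrreducibleModPGaloisRep p →
      IsImaginaryQuadratic K → Even S.card →
      (∀ ℓ ∈ S, ℓ.Prime ∧ ℓ ∣ N ∧ ¬ ℓ ^ 2 ∣ N ∧
        ((Ideal.span {(ℓ : ℤ)}).primesOver (𝓞 K)).ncard = 1 ∧ ¬ (ℓ : ℤ) ∣ NumberField.discr K) →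
      (∀ ℓ : ℕ, ℓ.Prime → ℓ ∣ N → ℓ ∉ S → ((Ideal.span {(ℓ : ℤ)}).primesOver (𝓞 K)).ncard = 2) →
      ((Ideal.span {(p : ℤ)}).primesOver (𝓞 K)).ncard = 2 →
      P₀.IsMinimalFor W →
      p ∣ N → p = 3 →
      ∀ (P : (W.baseChange K).toAffine.Point) (degS : ℕ), 0 < degS →
        padicValNat p degS = padicValNat p P₀.deg →
        LDerivEK W K =
          8 * (Real.pi : ℂ) ^ 2 * peterssonProduct (Gamma0 N) 2 Dt.f Dt.f /
              ((((Units.torsionOrder K : ℝ) / 2) ^ 2 * √|(NumberField.discr K : ℝ)| : ℝ) : ℂ) *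
            ((P.canonicalHeight : ℂ) / (degS : ℂ)) →
        ¬ IsOfFinAddOrder P →
          Nat.card (AddCommGroup.primaryComponent (W.baseChange K).sha p) ≤
            p ^ (2 * padicValNat p (AddSubgroup.zmultiples P).index)) :
    Summit.BirchSwinnertonDyer.BirchSwinnertonDyer.Theses.KolyvaginRoadThree.ShimuraKolyvaginOrderBoundAtThree := by
  intro W _ _ p _ N _ K _ _ S Dt X W' _ P₀ hN hp2 hirr hK hev hin hsp hps hmin hpN hp3 P degS h0 hv hL hnt
  rcases S.eq_empty_or_nonempty with hS | hS
  · exact stub_rung_orderBound_SEmptyAtThree_of_publishedInputsKolyThree h₇ W p N K S Dt X W' P₀ hN hS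
      hp2 hirr hK hev hin hsp hps hmin hpN hp3 P degS h0 hv hL hnt
  · exact hKO' W p N K S Dt X W' P₀ hN hS hp2 hirr hK hev hin hsp hps hmin hpN hp3 P degS h0 hv hL hnt

/-- **The two routes' copies of the crux decl are the same proposition** (identical text; `Iff.rfl`),
recorded so that either `_of_nonempty` theorem serves both routes. [folklore] -/
theorem shimuraKolyvaginOrderBoundAtThree_koly_iff :
    Summit.BirchSwinnertonDyer.BirchSwinnertonDyer.Theses.KolyvaginRoadThree.ShimuraKolyvaginOrderBoundAtThree ↔
      Summit.BirchSwinnertonDyer.BirchSwinnertonDyer.Theses.ClassRecordThree.ShimuraKolyvaginOrderBoundAtThree :=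
  Iff.rfl

end Summit.BirchSwinnertonDyer.BirchSwinnertonDyer.Theorems.ShimuraKolyvaginRungSEmpty

end
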